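import Summits.NavierStokesRegularity.NavierStokesRegularity.Theorems.FilamentSkeletonRssKelvinGateClosingPicard

/-!
# Route `FilamentSkeletonRss` · crux `TransverseReductionRJ` (stmt-NavierStokesRegularity-21221) — line `kelvin_gate`,
# stub S2 `PolynomialKelvinGate`: the NEUMANN SERIES in the Y-scale (linear fixed points `G = F − T G`)

Helper file (theorems only, `--supports stmt-NavierStokesRegularity-21221 --as helper`), in the vocabulary of
`FilamentSkeletonRssKelvinGateDefs` / `…Tools` / `…ClosingPicard`.  HONEST FRAMING: bookkeeping for a HYPOTHETICAL
filament-type RSS blow-up route; nothing here bears on Navier–Stokes regularity; no stub is proved here.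

The linear companion of the Picard file `…KelvinGateClosingPicard` (which treats the QUADRATIC map of stub S3).  For
an operator `T` on forcing fields of `ℝ³` which is LINEAR on Y-bounded data and CONTRACTS the Y-scale by a factor
`θ ≤ ½` (`YBound G R → YBound (T G) (θ R)`), the affine equation `G = F − T G` — i.e. `(1 + T) G = F`, the Neumann
series — is uniquely solvable among Y-bounded fields, with `Y(G) ≤ 2 Y(F)`, and the solution operator is linear on
Y-bounded data:

* `yScale_limit_of_geometric` — COMPLETENESS of the Y-scale along geometric sequences (factored out of the Picard
  proof): a sequence with `Y(F_n) ≤ B` and `Y(F_{n+1} − F_n) ≤ c 2^{-n}` has a `C¹` limit with `Y ≤ B`, tails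
  `Y(F_n − F_∞) ≤ 2c 2^{-n}`, and pointwise convergence of the fields and of their derivatives;
* `neumann_seq_bounds` / `neumann_exists` / `neumann_unique` / `neumann_solution` / `neumann_linear`.

USE (file `…KelvinGatePerturbation`): with `T G := D(𝓚_p G)[V] + DV[𝓚_p G]` for a Kelvin gate `𝓚_p` and an X-small
perturbation `V` of the base family, the solution operator conjugates the gate at `U⁰` into a gate at `U⁰ + V`
(clauses (1) + (2) of `GateSpec`), which is the mechanism by which ONE gate per branch of base families would serve
all `Γ^{-k}`-exact bases of high order (see `…KelvinGateOrderOne` for why the registered quantifier prefix does not yet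
let the stub profit from this).
-/

set_option linter.dupNamespace false

noncomputable section

namespace Summit.NavierStokesRegularity.NavierStokesRegularity.Theorems.KelvinGate

open Set Function Filter
open Literature.Analysis.FluidPDE
open scoped InnerProductSpace Laplacian ContDiff Topology

/-! ## Completeness of the Y-scale along geometric sequences -/

/-- **The Y-scale is complete along geometric sequences.**  If `Y(F_n) ≤ B` for all `n` and the increments satisfy
`Y(F_{n+1} − F_n) ≤ c · (½)^n`, then there is a `C¹` field `F_∞` with `Y(F_∞) ≤ B`, `Y(F_n − F_∞) ≤ 2c (½)^n`, and
`F_n(y) → F_∞(y)`, `DF_n(y) → DF_∞(y)` for every `y`.  (Pointwise geometric Cauchy estimates in `ℝ³` and `ℝ³ →L ℝ³`;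
the derivatives converge uniformly because the weight is `≥ 1`; `hasFDerivAt_of_tendstoUniformly`.) -/
theorem yScale_limit_of_geometric {Fs : ℕ → EuclideanSpace ℝ (Fin 3) → EuclideanSpace ℝ (Fin 3)} {B c : ℝ}
    (hB : ∀ n, YBound (Fs n) B) (hinc : ∀ n, YBound (fun y => Fs (n + 1) y - Fs n y) (c * (1 / 2) ^ n)) :
    ∃ Flim : EuclideanSpace ℝ (Fin 3) → EuclideanSpace ℝ (Fin 3), YBound Flim B ∧
      (∀ n, YBound (fun y => Fs n y - Flim y) (2 * c * (1 / 2) ^ n)) ∧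
      (∀ y, Tendsto (fun n => Fs n y) atTop (𝓝 (Flim y))) ∧
      (∀ y, Tendsto (fun n => fderiv ℝ (Fs n) y) atTop (𝓝 (fderiv ℝ Flim y))) := by
  have hc : 0 ≤ c := by simpa using (hinc 0).nonneg
  have hC1s : ∀ n, ContDiff ℝ 1 (Fs n) := fun n => (hB n).1
  have hdiff : ∀ n y, DifferentiableAt ℝ (Fs n) y := fun n y => (hC1s n).differentiable (by norm_num) y
  -- weighted geometric increments, for the fields and for their derivatives
  have hdist : ∀ y n, dist (Fs n y) (Fs (n + 1) y) ≤ c / (1 + ‖y‖) ^ 2 * (1 / 2) ^ n := by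
    intro y n
    rw [dist_comm, dist_eq_norm]
    calc ‖Fs (n + 1) y - Fs n y‖ ≤ c * (1 / 2) ^ n / (1 + ‖y‖) ^ 2 := (hinc n).norm_le y
      _ = c / (1 + ‖y‖) ^ 2 * (1 / 2) ^ n := by ring
  have hdistD : ∀ y n, dist (fderiv ℝ (Fs n) y) (fderiv ℝ (Fs (n + 1)) y) ≤ c / (1 + ‖y‖) ^ 2 * (1 / 2) ^ n := by
    intro y n
    rw [dist_comm, dist_eq_norm]
    have h := ((hinc n).2 y).2
    rw [fderiv_fun_sub (hdiff (n + 1) y) (hdiff n y)] at h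
    have e : c / (1 + ‖y‖) ^ 2 * (1 / 2 : ℝ) ^ n = c * (1 / 2) ^ n / (1 + ‖y‖) ^ 2 := by ring
    rw [e, le_div_iff₀ (by positivity)]
    calc ‖fderiv ℝ (Fs (n + 1)) y - fderiv ℝ (Fs n) y‖ * (1 + ‖y‖) ^ 2
        = (1 + ‖y‖) ^ 2 * ‖fderiv ℝ (Fs (n + 1)) y - fderiv ℝ (Fs n) y‖ := by ring
      _ ≤ c * (1 / 2) ^ n := h
  -- pointwise limits (values in `ℝ³`, derivatives in `ℝ³ →L ℝ³`; both complete)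
  have hlimF : ∀ y, ∃ v, Tendsto (fun n => Fs n y) atTop (𝓝 v) := fun y =>
    cauchySeq_tendsto_of_complete (cauchySeq_of_le_geometric (1 / 2) _ (by norm_num) (hdist y))
  have hlimD : ∀ y, ∃ L, Tendsto (fun n => fderiv ℝ (Fs n) y) atTop (𝓝 L) := fun y =>
    cauchySeq_tendsto_of_complete (cauchySeq_of_le_geometric (1 / 2) _ (by norm_num) (hdistD y))
  choose Flim hFlim using hlimF
  choose Glim hGlim using hlimD
  -- geometric tails
  have htail : ∀ y n, dist (Fs n y) (Flim y) ≤ 2 * c / (1 + ‖y‖) ^ 2 * (1 / 2) ^ n := by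
    intro y n
    have h := dist_le_of_le_geometric_of_tendsto (1 / 2) _ (by norm_num) (hdist y) (hFlim y) n
    calc dist (Fs n y) (Flim y) ≤ c / (1 + ‖y‖) ^ 2 * (1 / 2) ^ n / (1 - 1 / 2) := h
      _ = 2 * c / (1 + ‖y‖) ^ 2 * (1 / 2) ^ n := by ring
  have htailD : ∀ y n, dist (fderiv ℝ (Fs n) y) (Glim y) ≤ 2 * c / (1 + ‖y‖) ^ 2 * (1 / 2) ^ n := by
    intro y n
    have h := dist_le_of_le_geometric_of_tendsto (1 / 2) _ (by norm_num) (hdistD y) (hGlim y) n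
    calc dist (fderiv ℝ (Fs n) y) (Glim y) ≤ c / (1 + ‖y‖) ^ 2 * (1 / 2) ^ n / (1 - 1 / 2) := h
      _ = 2 * c / (1 + ‖y‖) ^ 2 * (1 / 2) ^ n := by ring
  -- the derivatives converge uniformly (the weight is `≥ 1`)
  have hpow0 : Tendsto (fun n : ℕ => 2 * c * (1 / 2 : ℝ) ^ n) atTop (𝓝 0) := by
    have h := (tendsto_pow_atTop_nhds_zero_of_lt_one (by norm_num : (0:ℝ) ≤ 1 / 2)
      (by norm_num : (1 / 2 : ℝ) < 1)).const_mul (2 * c)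
    rwa [mul_zero] at h
  have hunif : TendstoUniformly (fun n y => fderiv ℝ (Fs n) y) Glim atTop := by
    rw [Metric.tendstoUniformly_iff]
    intro δ hδ
    filter_upwards [(hpow0.eventually (gt_mem_nhds hδ))] with n hn y
    rw [dist_comm]
    have hw : (1:ℝ) ≤ (1 + ‖y‖) ^ 2 := by nlinarith [norm_nonneg y]
    calc dist (fderiv ℝ (Fs n) y) (Glim y) ≤ 2 * c / (1 + ‖y‖) ^ 2 * (1 / 2) ^ n := htailD y n
      _ ≤ 2 * c / 1 * (1 / 2) ^ n := by gcongr
      _ = 2 * c * (1 / 2) ^ n := by ring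
      _ < δ := hn
  -- the limit is `C¹` with derivative `Glim`
  have hderiv : ∀ y, HasFDerivAt Flim (Glim y) y :=
    hasFDerivAt_of_tendstoUniformly hunif (fun n y => (hdiff n y).hasFDerivAt) hFlim
  have hfd : fderiv ℝ Flim = Glim := funext fun y => (hderiv y).fderiv
  have hC1 : ContDiff ℝ 1 Flim := by
    rw [contDiff_one_iff_fderiv]
    refine ⟨fun y => (hderiv y).differentiableAt, ?_⟩
    rw [hfd]
    exact hunif.continuous (Eventually.of_forall fun n => (hC1s n).continuous_fderiv one_ne_zero).frequently
  -- weighted bounds pass to the limit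
  have hYlim : YBound Flim B := by
    refine ⟨hC1, fun y => ⟨?_, ?_⟩⟩
    · refine le_of_tendsto ((hFlim y).norm.const_mul ((1 + ‖y‖) ^ 2)) (Eventually.of_forall fun n => ?_)
      exact ((hB n).2 y).1
    · rw [hfd]
      refine le_of_tendsto ((hGlim y).norm.const_mul ((1 + ‖y‖) ^ 2)) (Eventually.of_forall fun n => ?_)
      exact ((hB n).2 y).2
  have hYdiff : ∀ n, YBound (fun y => Fs n y - Flim y) (2 * c * (1 / 2) ^ n) := by
    intro n
    refine ⟨(hC1s n).sub hC1, fun y => ⟨?_, ?_⟩⟩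
    · calc (1 + ‖y‖) ^ 2 * ‖Fs n y - Flim y‖ = dist (Fs n y) (Flim y) * (1 + ‖y‖) ^ 2 := by
            rw [dist_eq_norm]; ring
        _ ≤ 2 * c / (1 + ‖y‖) ^ 2 * (1 / 2) ^ n * (1 + ‖y‖) ^ 2 :=
            mul_le_mul_of_nonneg_right (htail y n) (by positivity)
        _ = 2 * c * (1 / 2) ^ n := by field_simp
    · rw [fderiv_fun_sub (hdiff n y) ((hderiv y).differentiableAt), hfd]
      calc (1 + ‖y‖) ^ 2 * ‖fderiv ℝ (Fs n) y - Glim y‖ = dist (fderiv ℝ (Fs n) y) (Glim y) * (1 + ‖y‖) ^ 2 := by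
            rw [dist_eq_norm]; ring
        _ ≤ 2 * c / (1 + ‖y‖) ^ 2 * (1 / 2) ^ n * (1 + ‖y‖) ^ 2 :=
            mul_le_mul_of_nonneg_right (htailD y n) (by positivity)
        _ = 2 * c * (1 / 2) ^ n := by field_simp
  refine ⟨Flim, hYlim, hYdiff, hFlim, fun y => ?_⟩
  rw [hfd]
  exact hGlim y

/-! ## The Neumann series `G = F − T G` for a Y-contracting linear `T` -/

section Neumann

variable {T : (EuclideanSpace ℝ (Fin 3) → EuclideanSpace ℝ (Fin 3)) →
    EuclideanSpace ℝ (Fin 3) → EuclideanSpace ℝ (Fin 3)} {θ : ℝ}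

/-- `T` kills the zero field (the Y-bound of radius `θ · 0 = 0`). -/
theorem neumann_T_zero
    (hT1 : ∀ (G : EuclideanSpace ℝ (Fin 3) → EuclideanSpace ℝ (Fin 3)) (R : ℝ), YBound G R → YBound (T G) (θ * R)) :
    T (fun _ => 0) = fun _ => 0 := by
  have h := hT1 (fun _ => 0) 0 yBound_zero
  rw [mul_zero] at h
  exact h.eq_zero_of_nonpos le_rfl

/-- **The Neumann iterates** `G₀ = 0`, `G_{n+1} = F − T G_n` stay in the ball `Y ≤ 2 Y(F)` and have geometric
increments `Y(G_{n+1} − G_n) ≤ Y(F) (½)^n` (contraction factor `θ ≤ ½`, linearity of `T` on Y-bounded data). -/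
theorem neumann_seq_bounds
    (hT1 : ∀ (G : EuclideanSpace ℝ (Fin 3) → EuclideanSpace ℝ (Fin 3)) (R : ℝ), YBound G R → YBound (T G) (θ * R))
    (hT2 : ∀ (G H : EuclideanSpace ℝ (Fin 3) → EuclideanSpace ℝ (Fin 3)) (s : ℝ), (∃ R, YBound G R) →
      (∃ R, YBound H R) → T (fun y => G y + s • H y) = fun y => T G y + s • T H y)
    (hθ : θ ≤ 1 / 2) {F : EuclideanSpace ℝ (Fin 3) → EuclideanSpace ℝ (Fin 3)} {R : ℝ} (hF : YBound F R)
    {Gs : ℕ → EuclideanSpace ℝ (Fin 3) → EuclideanSpace ℝ (Fin 3)} (h0 : Gs 0 = fun _ => 0)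
    (hsucc : ∀ n, Gs (n + 1) = fun y => F y - T (Gs n) y) (n : ℕ) :
    YBound (Gs n) (2 * R) ∧ YBound (fun y => Gs (n + 1) y - Gs n y) (R * (1 / 2) ^ n) := by
  have hR : 0 ≤ R := hF.nonneg
  -- the ball is preserved: `Y(F − T G) ≤ R + θ · 2R ≤ 2R`
  have hball : ∀ G : EuclideanSpace ℝ (Fin 3) → EuclideanSpace ℝ (Fin 3), YBound G (2 * R) →
      YBound (fun y => F y - T G y) (2 * R) := by
    intro G hG
    refine (hF.sub (hT1 G _ hG)).mono ?_
    nlinarith [mul_nonneg (sub_nonneg.mpr hθ) hR]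
  induction n with
  | zero =>
    have hz : YBound (fun _ : EuclideanSpace ℝ (Fin 3) => (0 : EuclideanSpace ℝ (Fin 3))) (2 * R) :=
      yBound_zero.mono (by linarith)
    rw [h0]
    refine ⟨hz, ?_⟩
    rw [hsucc 0, h0, neumann_T_zero hT1]
    simpa using hF
  | succ n ih =>
    obtain ⟨hn, hdn⟩ := ih
    have hn1 : YBound (Gs (n + 1)) (2 * R) := by
      rw [hsucc n]; exact hball _ hn
    refine ⟨hn1, ?_⟩
    -- `G_{n+2} − G_{n+1} = −T (G_{n+1} − G_n)`
    have hsub := picard_K_sub (K := T) hT2 hn1 hn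
    have e : (fun y => Gs (n + 1 + 1) y - Gs (n + 1) y) = fun y => -T (fun z => Gs (n + 1) z - Gs n z) y := by
      funext y
      have e1 : Gs (n + 1 + 1) y = F y - T (Gs (n + 1)) y := congrFun (hsucc (n + 1)) y
      have e2 : Gs (n + 1) y = F y - T (Gs n) y := congrFun (hsucc n) y
      rw [e1, e2, hsub y]
      abel
    rw [e]
    refine ((hT1 _ _ hdn).neg).mono ?_
    have hp : 0 ≤ R * (1 / 2 : ℝ) ^ n := by positivity
    calc θ * (R * (1 / 2) ^ n) ≤ (1 / 2) * (R * (1 / 2) ^ n) := mul_le_mul_of_nonneg_right hθ hp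
      _ = R * (1 / 2) ^ (n + 1) := by rw [pow_succ]; ring

/-- **Existence for the Neumann series.**  For `T` linear on Y-bounded data with `Y(T G) ≤ θ Y(G)`, `θ ≤ ½`, and every
`F` with `Y(F) ≤ R`, there is `G` with `Y(G) ≤ 2R` and `G = F − T G` pointwise. -/
theorem neumann_exists
    (hT1 : ∀ (G : EuclideanSpace ℝ (Fin 3) → EuclideanSpace ℝ (Fin 3)) (R : ℝ), YBound G R → YBound (T G) (θ * R))
    (hT2 : ∀ (G H : EuclideanSpace ℝ (Fin 3) → EuclideanSpace ℝ (Fin 3)) (s : ℝ), (∃ R, YBound G R) →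
      (∃ R, YBound H R) → T (fun y => G y + s • H y) = fun y => T G y + s • T H y)
    (hθ : θ ≤ 1 / 2) {F : EuclideanSpace ℝ (Fin 3) → EuclideanSpace ℝ (Fin 3)} {R : ℝ} (hF : YBound F R) :
    ∃ G : EuclideanSpace ℝ (Fin 3) → EuclideanSpace ℝ (Fin 3), YBound G (2 * R) ∧ ∀ y, G y = F y - T G y := by
  obtain ⟨Gs, h0, hsucc⟩ : ∃ Gs : ℕ → EuclideanSpace ℝ (Fin 3) → EuclideanSpace ℝ (Fin 3), (Gs 0 = fun _ => 0) ∧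
      ∀ n, Gs (n + 1) = fun y => F y - T (Gs n) y :=
    ⟨fun n => (fun G => fun y => F y - T G y)^[n] (fun _ => 0), rfl, fun n => Function.iterate_succ_apply' _ n _⟩
  have hb := fun n => neumann_seq_bounds hT1 hT2 hθ hF h0 hsucc n
  obtain ⟨Glim, hYlim, hYdiff, hlim, -⟩ :=
    yScale_limit_of_geometric (fun n => (hb n).1) (fun n => (hb n).2)
  refine ⟨Glim, hYlim, fun y => ?_⟩
  -- pass to the limit in `G_{n+1} = F − T G_n`, using `T G_n − T G_∞ = T (G_n − G_∞)` Y-small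
  have hsplit : ∀ n, T (Gs n) y = T Glim y + T (fun z => Gs n z - Glim z) y := fun n =>
    picard_K_sub (K := T) hT2 (hb n).1 hYlim y
  have hsmall : ∀ n, ‖T (fun z => Gs n z - Glim z) y‖ ≤ θ * (2 * R * (1 / 2) ^ n) := fun n =>
    ((hT1 _ _ (hYdiff n)).norm_le' y).1
  have hpow : Tendsto (fun n : ℕ => θ * (2 * R * (1 / 2 : ℝ) ^ n)) atTop (𝓝 0) := by
    have h := (tendsto_pow_atTop_nhds_zero_of_lt_one (by norm_num : (0:ℝ) ≤ 1 / 2)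
      (by norm_num : (1 / 2 : ℝ) < 1)).const_mul (θ * (2 * R))
    rw [mul_zero] at h
    exact h.congr fun n => by ring
  have hTv : Tendsto (fun n => T (fun z => Gs n z - Glim z) y) atTop (𝓝 0) := by
    rw [tendsto_zero_iff_norm_tendsto_zero]
    exact squeeze_zero (fun n => norm_nonneg _) hsmall hpow
  have hT : Tendsto (fun n => T (Gs n) y) atTop (𝓝 (T Glim y)) := by
    have h := (tendsto_const_nhds (x := T Glim y)).add hTv
    rw [add_zero] at h
    exact h.congr fun n => (hsplit n).symm
  have hrhs : Tendsto (fun n => F y - T (Gs n) y) atTop (𝓝 (F y - T Glim y)) := tendsto_const_nhds.sub hT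
  have hlhs : Tendsto (fun n => Gs (n + 1) y) atTop (𝓝 (Glim y)) := (hlim y).comp (tendsto_add_atTop_nat 1)
  have heq : (fun n => Gs (n + 1) y) = fun n => F y - T (Gs n) y := funext fun n => congrFun (hsucc n) y
  rw [heq] at hlhs
  exact tendsto_nhds_unique hlhs hrhs

/-- **Uniqueness for the Neumann series** among Y-bounded fields: two Y-bounded solutions of `G = F − T G` coincide
(their difference `d` satisfies `d = −T d`, so `Y(d) ≤ s ⇒ Y(d) ≤ s/2 ⇒ … ⇒ d = 0`). -/
theorem neumann_unique
    (hT1 : ∀ (G : EuclideanSpace ℝ (Fin 3) → EuclideanSpace ℝ (Fin 3)) (R : ℝ), YBound G R → YBound (T G) (θ * R))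
    (hT2 : ∀ (G H : EuclideanSpace ℝ (Fin 3) → EuclideanSpace ℝ (Fin 3)) (s : ℝ), (∃ R, YBound G R) →
      (∃ R, YBound H R) → T (fun y => G y + s • H y) = fun y => T G y + s • T H y)
    (hθ : θ ≤ 1 / 2) {F G G' : EuclideanSpace ℝ (Fin 3) → EuclideanSpace ℝ (Fin 3)}
    (hG : ∃ R, YBound G R) (hG' : ∃ R, YBound G' R)
    (hfix : ∀ y, G y = F y - T G y) (hfix' : ∀ y, G' y = F y - T G' y) : G = G' := by
  obtain ⟨R, hR⟩ := hG
  obtain ⟨R', hR'⟩ := hG'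
  -- `d := G − G'` solves `d = −T d`
  have hsub := picard_K_sub (K := T) hT2 hR hR'
  have hd_eq : ∀ y, G y - G' y = -T (fun z => G z - G' z) y := by
    intro y
    rw [hfix y, hfix' y, hsub y]
    abel
  have hd0 : YBound (fun y => G y - G' y) (R + R') := hR.sub hR'
  -- halving
  have hhalf : ∀ s, YBound (fun y => G y - G' y) s → YBound (fun y => G y - G' y) (s / 2) := by
    intro s hs
    have hs0 : 0 ≤ s := hs.nonneg
    have h := (hT1 _ _ hs).neg
    have e : (fun y => -T (fun z => G z - G' z) y) = fun y => G y - G' y := funext fun y => (hd_eq y).symm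
    rw [e] at h
    refine h.mono ?_
    nlinarith [mul_nonneg (sub_nonneg.mpr hθ) hs0]
  have hiter : ∀ n : ℕ, YBound (fun y => G y - G' y) ((R + R') * (1 / 2) ^ n) := by
    intro n
    induction n with
    | zero => simpa using hd0
    | succ n ih =>
      have h := hhalf _ ih
      refine h.mono (le_of_eq ?_)
      rw [pow_succ]; ring
  funext y
  have hle : ∀ n : ℕ, ‖G y - G' y‖ ≤ (R + R') * (1 / 2) ^ n := fun n => ((hiter n).norm_le' y).1
  have hpow : Tendsto (fun n : ℕ => (R + R') * (1 / 2 : ℝ) ^ n) atTop (𝓝 0) := by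
    have h := (tendsto_pow_atTop_nhds_zero_of_lt_one (by norm_num : (0:ℝ) ≤ 1 / 2)
      (by norm_num : (1 / 2 : ℝ) < 1)).const_mul (R + R')
    rwa [mul_zero] at h
  have h0 : ‖G y - G' y‖ ≤ 0 := le_of_tendsto_of_tendsto tendsto_const_nhds hpow (Eventually.of_forall hle)
  exact sub_eq_zero.mp (norm_le_zero_iff.mp h0)

/-- **The Neumann solution operator, pointwise in `F`.**  For every forcing `F` there is a field `G` which, whenever
`F` is Y-bounded by `R`, is Y-bounded by `2R` and solves `G = F − T G` (for non-Y-bounded `F` both clauses are void;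
uniqueness makes the bound hold for EVERY admissible radius `R` simultaneously). -/
theorem neumann_solution
    (hT1 : ∀ (G : EuclideanSpace ℝ (Fin 3) → EuclideanSpace ℝ (Fin 3)) (R : ℝ), YBound G R → YBound (T G) (θ * R))
    (hT2 : ∀ (G H : EuclideanSpace ℝ (Fin 3) → EuclideanSpace ℝ (Fin 3)) (s : ℝ), (∃ R, YBound G R) →
      (∃ R, YBound H R) → T (fun y => G y + s • H y) = fun y => T G y + s • T H y)
    (hθ : θ ≤ 1 / 2) (F : EuclideanSpace ℝ (Fin 3) → EuclideanSpace ℝ (Fin 3)) :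
    ∃ G : EuclideanSpace ℝ (Fin 3) → EuclideanSpace ℝ (Fin 3),
      (∀ R, YBound F R → YBound G (2 * R)) ∧ (∀ R, YBound F R → ∀ y, G y = F y - T G y) := by
  by_cases h : ∃ R, YBound F R
  · obtain ⟨R₀, h₀⟩ := h
    obtain ⟨G, hG, hfix⟩ := neumann_exists hT1 hT2 hθ h₀
    refine ⟨G, fun R hR => ?_, fun _ _ => hfix⟩
    obtain ⟨G', hG', hfix'⟩ := neumann_exists hT1 hT2 hθ hR
    have e : G = G' := neumann_unique hT1 hT2 hθ ⟨_, hG⟩ ⟨_, hG'⟩ hfix hfix'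
    rw [e]
    exact hG'
  · push Not at h
    exact ⟨fun _ => 0, fun R hR => absurd hR (h R), fun R hR => absurd hR (h R)⟩

/-- **Linearity of the Neumann solution operator** on Y-bounded data: any operator `S` which returns, on Y-bounded
`F`, a Y-bounded solution of `S F = F − T (S F)` satisfies `S (F + s H) = S F + s · S H` (both sides are Y-bounded
solutions of the equation with datum `F + s H`; `neumann_unique`). -/
theorem neumann_linear
    (hT1 : ∀ (G : EuclideanSpace ℝ (Fin 3) → EuclideanSpace ℝ (Fin 3)) (R : ℝ), YBound G R → YBound (T G) (θ * R))
    (hT2 : ∀ (G H : EuclideanSpace ℝ (Fin 3) → EuclideanSpace ℝ (Fin 3)) (s : ℝ), (∃ R, YBound G R) →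
      (∃ R, YBound H R) → T (fun y => G y + s • H y) = fun y => T G y + s • T H y)
    (hθ : θ ≤ 1 / 2)
    {S : (EuclideanSpace ℝ (Fin 3) → EuclideanSpace ℝ (Fin 3)) → EuclideanSpace ℝ (Fin 3) → EuclideanSpace ℝ (Fin 3)}
    (hS1 : ∀ (F : EuclideanSpace ℝ (Fin 3) → EuclideanSpace ℝ (Fin 3)) (R : ℝ), YBound F R → YBound (S F) (2 * R))
    (hS2 : ∀ (F : EuclideanSpace ℝ (Fin 3) → EuclideanSpace ℝ (Fin 3)) (R : ℝ), YBound F R →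
      ∀ y, S F y = F y - T (S F) y)
    (F H : EuclideanSpace ℝ (Fin 3) → EuclideanSpace ℝ (Fin 3)) (s : ℝ) (hF : ∃ R, YBound F R)
    (hH : ∃ R, YBound H R) :
    S (fun y => F y + s • H y) = fun y => S F y + s • S H y := by
  obtain ⟨R, hR⟩ := hF
  obtain ⟨R', hR'⟩ := hH
  have hFH : YBound (fun y => F y + s • H y) (R + |s| * R') := hR.add (hR'.smul s)
  have hSF : YBound (S F) (2 * R) := hS1 F R hR
  have hSH : YBound (S H) (2 * R') := hS1 H R' hR'
  have hL : YBound (fun y => S F y + s • S H y) (2 * R + |s| * (2 * R')) := hSF.add (hSH.smul s)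
  -- the candidate `S F + s · S H` solves the equation with datum `F + s H`
  have hTlin := hT2 (S F) (S H) s ⟨_, hSF⟩ ⟨_, hSH⟩
  have hfixL : ∀ y, (fun y => S F y + s • S H y) y =
      (fun y => F y + s • H y) y - T (fun y => S F y + s • S H y) y := by
    intro y
    show S F y + s • S H y = (F y + s • H y) - T (fun y => S F y + s • S H y) y
    rw [hTlin]
    show S F y + s • S H y = (F y + s • H y) - (T (S F) y + s • T (S H) y)
    rw [hS2 F R hR y, hS2 H R' hR' y, smul_sub]
    abel
  exact neumann_unique hT1 hT2 hθ ⟨_, hS1 _ _ hFH⟩ ⟨_, hL⟩ (hS2 _ _ hFH) hfixL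

end Neumann

end Summit.NavierStokesRegularity.NavierStokesRegularity.Theorems.KelvinGate
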